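import Summits.AnomalousDissipation.AnomalousDissipation.Theorems.SolenoidalFractalHomogenisationRealisedQuasiStaticCellLawSlavedPairWindow
import Literature.Analysis.FluidPDE.QuasiStaticSlotWeight
import HarnessLib

/-!
# K2R `RealisedQuasiStaticCellLaw`, line `floquet-bloch`, stub `stub_lowSectorDecay` (S1D): the slaved pair with a joint
# co-moving slow form over one trapezoid slot

Summits-side helper file (everything proved; no definitions, no named facts; `--supports stmt-AnomalousDissipation-20446`).
`slavedPair_window` applied on the three affine pieces of the slot coupling `g = g₁·trapezoid 0 τ ρ (· − t₀)` (weights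
`a, b, c` given on the whole slot with their co-moving derivatives); at the two ends of the slot the slaving profiles vanish,
so the fast parts are the plain energies `Σ_{J≠0}‖v^k_J‖²`. Result (`slavedPair_trapezoid`): over the slot the pair
functional contracts by `exp(−2(1−ε)λ̄τ + (40βγ²Λτg₁⁴(1+g₁²σ²)/Δ³ + 48βγ²g₁²/(ρτΛΔ³))/G_min)`.
-/

set_option linter.dupNamespace false

namespace Summit.AnomalousDissipation.AnomalousDissipation.Theorems.SolenoidalFractalHomogenisation.RealisedQuasiStaticCellLaw

noncomputable section

open Set Finset Complex
open scoped BigOperators ComplexConjugate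
open Literature.Analysis.FluidPDE Literature.Analysis.FluidPDE.LatticeShear

/-- **Slaved pair over a trapezoid slot (co-moving slow form, constant target rate).** -/
theorem slavedPair_trapezoid (W : Finset ℤ) (h0 : (0 : ℤ) ∈ W) (h1 : (1 : ℤ) ∈ W) (hm1 : (-1 : ℤ) ∈ W)
    (d s₁ s₂ : ℤ → ℝ) (Λ Δ γ σ₁ σ₂ σ ε β lam Gmax Gmin g₁ τ ρ t₀ : ℝ) (g wa wb : ℝ → ℝ) (wc : ℝ → ℂ)
    (v₁ v₂ : ℝ → ℤ → ℂ)
    (hs₁ : ∀ J ∈ W, |s₁ J| ≤ 1) (hs₂ : ∀ J ∈ W, |s₂ J| ≤ 1)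
    (hγ₁ : s₁ 0 ^ 2 + s₁ (-1) ^ 2 ≤ γ ^ 2) (hγ₂ : s₂ 0 ^ 2 + s₂ (-1) ^ 2 ≤ γ ^ 2) (hγ0 : 0 ≤ γ)
    (hσ₁ : σ₁ = s₁ (-1) ^ 2 / (d (-1) - d 0) + s₁ 0 ^ 2 / (d 1 - d 0))
    (hσ₂ : σ₂ = s₂ (-1) ^ 2 / (d (-1) - d 0) + s₂ 0 ^ 2 / (d 1 - d 0))
    (hσ₁le : σ₁ ≤ σ) (hσ₂le : σ₂ ≤ σ)
    (hΔ0 : 0 < Δ) (hΔ : ∀ J ∈ W, J ≠ 0 → d 0 + Δ ≤ d J) (hd0 : 0 ≤ d 0) (hΛ : 0 < Λ) (hε : 0 ≤ ε) (hβ : 0 ≤ β)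
    (hlam : 0 ≤ lam) (hGmin : 0 < Gmin)
    (hGmax : ∀ t ∈ Icc t₀ (t₀ + τ), wa t ≤ Gmax ∧ wb t ≤ Gmax ∧ ‖wc t‖ ≤ Gmax)
    (hG : ∀ t ∈ Icc t₀ (t₀ + τ), ∀ y₁ y₂ : ℂ,
      Gmin * (‖y₁‖ ^ 2 + ‖y₂‖ ^ 2) ≤ wa t * ‖y₁‖ ^ 2 + wb t * ‖y₂‖ ^ 2 + 2 * (wc t * conj y₁ * y₂).re)
    (hβ' : 16 * Gmax ^ 2 * g₁ ^ 2 * Λ * γ ^ 2 ≤ Gmin * ε * lam * β * Δ)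
    (hτ : 0 < τ) (hρ : 0 < ρ) (hρ2 : ρ ≤ 1 / 2)
    (hgdef : ∀ t ∈ Icc t₀ (t₀ + τ), g t = g₁ * LatticeWord.trapezoid 0 τ ρ (t - t₀))
    (hsmall : g₁ ^ 2 * (4 * γ ^ 2 / Δ) + 2 * lam / Λ ≤ Δ)
    (hwa : ∀ t ∈ Icc t₀ (t₀ + τ), HasDerivWithinAt wa ((2 * (Λ * (d 0 + g t ^ 2 * σ₁) - lam)) * wa t) (Icc t₀ (t₀ + τ)) t)
    (hwb : ∀ t ∈ Icc t₀ (t₀ + τ), HasDerivWithinAt wb ((2 * (Λ * (d 0 + g t ^ 2 * σ₂) - lam)) * wb t) (Icc t₀ (t₀ + τ)) t)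
    (hwc : ∀ t ∈ Icc t₀ (t₀ + τ), HasDerivWithinAt wc
      ((((Λ * (d 0 + g t ^ 2 * σ₁) + Λ * (d 0 + g t ^ 2 * σ₂) - 2 * lam : ℝ) : ℂ) * wc t)) (Icc t₀ (t₀ + τ)) t)
    (hsupp₁ : ∀ t ∈ Icc t₀ (t₀ + τ), ∀ J, J ∉ W → v₁ t J = 0) (hsupp₂ : ∀ t ∈ Icc t₀ (t₀ + τ), ∀ J, J ∉ W → v₂ t J = 0)
    (hderiv₁ : ∀ t ∈ Icc t₀ (t₀ + τ), ∀ J ∈ W, HasDerivWithinAt (fun τ' => v₁ τ' J)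
        (-(Λ : ℂ) * ((d J : ℂ) * v₁ t J) -
          (g t : ℂ) * (Λ : ℂ) * ((s₁ (J - 1) : ℂ) * v₁ t (J - 1) - (s₁ J : ℂ) * v₁ t (J + 1))) (Icc t₀ (t₀ + τ)) t)
    (hderiv₂ : ∀ t ∈ Icc t₀ (t₀ + τ), ∀ J ∈ W, HasDerivWithinAt (fun τ' => v₂ τ' J)
        (-(Λ : ℂ) * ((d J : ℂ) * v₂ t J) -
          (g t : ℂ) * (Λ : ℂ) * ((s₂ (J - 1) : ℂ) * v₂ t (J - 1) - (s₂ J : ℂ) * v₂ t (J + 1))) (Icc t₀ (t₀ + τ)) t) :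
    wa (t₀ + τ) * ‖v₁ (t₀ + τ) 0‖ ^ 2 + wb (t₀ + τ) * ‖v₂ (t₀ + τ) 0‖ ^ 2 +
          2 * (wc (t₀ + τ) * conj (v₁ (t₀ + τ) 0) * v₂ (t₀ + τ) 0).re +
        β * (∑ J ∈ W.erase 0, ‖v₁ (t₀ + τ) J‖ ^ 2 + ∑ J ∈ W.erase 0, ‖v₂ (t₀ + τ) J‖ ^ 2) ≤
      Real.exp (-(2 * (1 - ε) * lam * τ) +
          (40 * β * γ ^ 2 * Λ * τ * g₁ ^ 4 * (1 + g₁ ^ 2 * σ ^ 2) / Δ ^ 3 +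
            48 * β * γ ^ 2 * g₁ ^ 2 / (ρ * τ * Λ * Δ ^ 3)) / Gmin) *
        (wa t₀ * ‖v₁ t₀ 0‖ ^ 2 + wb t₀ * ‖v₂ t₀ 0‖ ^ 2 + 2 * (wc t₀ * conj (v₁ t₀ 0) * v₂ t₀ 0).re +
          β * (∑ J ∈ W.erase 0, ‖v₁ t₀ J‖ ^ 2 + ∑ J ∈ W.erase 0, ‖v₂ t₀ J‖ ^ 2)) := by
  classical
  have hρτ : 0 < ρ * τ := mul_pos hρ hτ
  have h2ρτ : 2 * (ρ * τ) ≤ τ := by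
    have := mul_le_mul_of_nonneg_right hρ2 hτ.le; linarith only [this]
  have hρτle : ρ * τ ≤ τ := by linarith only [h2ρτ, hρτ.le]
  have hσ₁0 : 0 ≤ σ₁ := by
    have hδp : 0 < d 1 - d 0 := by linarith [hΔ 1 h1 (by norm_num)]
    have hδm : 0 < d (-1) - d 0 := by linarith [hΔ (-1) hm1 (by norm_num)]
    rw [hσ₁]; positivity
  have hσ0 : 0 ≤ σ := hσ₁0.trans hσ₁le
  -- the functional
  obtain ⟨Φ, hΦ⟩ : ∃ Φ : ℝ → ℝ, Φ = fun t =>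
      wa t * ‖v₁ t 0‖ ^ 2 + wb t * ‖v₂ t 0‖ ^ 2 + 2 * (wc t * conj (v₁ t 0) * v₂ t 0).re +
        β * (∑ J ∈ W.erase 0, ‖v₁ t J - ((if J = 1 then -(g t * s₁ 0 / (d 1 - d 0))
            else if J = -1 then g t * s₁ (-1) / (d (-1) - d 0) else 0 : ℝ) : ℂ) * v₁ t 0‖ ^ 2 +
          ∑ J ∈ W.erase 0, ‖v₂ t J - ((if J = 1 then -(g t * s₂ 0 / (d 1 - d 0))
            else if J = -1 then g t * s₂ (-1) / (d (-1) - d 0) else 0 : ℝ) : ℂ) * v₂ t 0‖ ^ 2) := ⟨_, rfl⟩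
  have hΦend : ∀ t, g t = 0 → Φ t = wa t * ‖v₁ t 0‖ ^ 2 + wb t * ‖v₂ t 0‖ ^ 2 + 2 * (wc t * conj (v₁ t 0) * v₂ t 0).re +
      β * (∑ J ∈ W.erase 0, ‖v₁ t J‖ ^ 2 + ∑ J ∈ W.erase 0, ‖v₂ t J‖ ^ 2) := by
    intro t hgt
    rw [hΦ]
    simp only [hgt, zero_mul, neg_zero, zero_div, ite_self, Complex.ofReal_zero, sub_zero]
  have hg_t₀ : g t₀ = 0 := by
    rw [hgdef t₀ ⟨le_rfl, by linarith⟩, sub_self,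
      trapezoid_eq_of_mem_ramp_up hτ hρ hρ2 ⟨le_rfl, hρτ.le⟩, zero_div, mul_zero]
  have hg_t₁ : g (t₀ + τ) = 0 := by
    rw [hgdef (t₀ + τ) ⟨by linarith, le_rfl⟩, add_sub_cancel_left,
      trapezoid_eq_of_mem_ramp_down hτ hρ hρ2 ⟨by linarith [mul_pos hρ hτ], le_rfl⟩, sub_self, zero_div, mul_zero]
  -- |g| ≤ |g₁|
  have hgT : ∀ t ∈ Icc t₀ (t₀ + τ), |g t| ≤ |g₁| := by
    intro t ht
    rw [hgdef t ht, abs_mul]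
    have h01 : 0 ≤ LatticeWord.trapezoid 0 τ ρ (t - t₀) ∧ LatticeWord.trapezoid 0 τ ρ (t - t₀) ≤ 1 := by
      unfold LatticeWord.trapezoid
      exact ⟨le_max_left _ _, max_le zero_le_one (min_le_left _ _)⟩
    rw [abs_of_nonneg h01.1]
    exact mul_le_of_le_one_right (abs_nonneg _) h01.2
  have hβ'' : 16 * Gmax ^ 2 * |g₁| ^ 2 * Λ * γ ^ 2 ≤ Gmin * ε * lam * β * Δ := by rw [sq_abs]; exact hβ'
  have hsmall' : |g₁| ^ 2 * (4 * γ ^ 2 / Δ) + 2 * lam / Λ ≤ Δ := by rw [sq_abs]; exact hsmall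
  -- the generic piece
  have hpiece : ∀ (a b c₀ c₁ gD : ℝ), t₀ ≤ a → a ≤ b → b ≤ t₀ + τ →
      (∀ t ∈ Icc a b, g t = c₀ + c₁ * t) → |c₁| ≤ gD →
      Φ b ≤ Real.exp (-(2 * ((1 - ε) * lam - 4 * β * γ ^ 2 * (Λ * |g₁| ^ 3 * σ + gD + Λ * |g₁| ^ 2) ^ 2 /
        (Gmin * Λ * Δ ^ 3)) * (b - a))) * Φ a := by
    intro a b c₀ c₁ gD ha hab hb hgab hc₁
    have hsub : Icc a b ⊆ Icc t₀ (t₀ + τ) := Icc_subset_Icc ha hb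
    have hgd : ∀ t ∈ Icc a b, HasDerivWithinAt g c₁ (Icc a b) t := by
      intro t ht
      have h1' : HasDerivWithinAt (fun t => c₀ + c₁ * t) c₁ (Icc a b) t := by
        simpa using ((hasDerivWithinAt_id t (Icc a b)).const_mul c₁).const_add c₀
      exact h1'.congr (fun y hy => hgab y hy) (hgab t ht)
    have h := slavedPair_window W h0 h1 hm1 d s₁ s₂ Λ |g₁| gD Δ γ σ₁ σ₂ σ ε β lam Gmax Gmin a b g (fun _ => c₁) wa wb wc
      v₁ v₂ hs₁ hs₂ hγ₁ hγ₂ hγ0 hσ₁ hσ₂ hσ₁le hσ₂le hΔ0 hΔ hd0 hΛ hε hβ hlam hGmin (fun t ht => hGmax t (hsub ht))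
      (fun t ht => hG t (hsub ht)) hβ'' (fun t ht => hgT t (hsub ht)) (fun t _ => hc₁) hgd hsmall'
      (fun t ht => (hwa t (hsub ht)).mono hsub) (fun t ht => (hwb t (hsub ht)).mono hsub)
      (fun t ht => (hwc t (hsub ht)).mono hsub) (fun t ht => hsupp₁ t (hsub ht)) (fun t ht => hsupp₂ t (hsub ht))
      (fun t ht J hJ => (hderiv₁ t (hsub ht) J hJ).mono hsub) (fun t ht J hJ => (hderiv₂ t (hsub ht) J hJ).mono hsub)
      b ⟨hab, le_rfl⟩
    rw [hΦ]
    exact h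
  have hΦ0 : 0 ≤ Φ t₀ := by
    rw [hΦ]
    have hS := hG t₀ ⟨le_rfl, by linarith⟩ (v₁ t₀ 0) (v₂ t₀ 0)
    have : 0 ≤ Gmin * (‖v₁ t₀ 0‖ ^ 2 + ‖v₂ t₀ 0‖ ^ 2) := by positivity
    have hF : 0 ≤ β * (∑ J ∈ W.erase 0, ‖v₁ t₀ J - ((if J = 1 then -(g t₀ * s₁ 0 / (d 1 - d 0))
            else if J = -1 then g t₀ * s₁ (-1) / (d (-1) - d 0) else 0 : ℝ) : ℂ) * v₁ t₀ 0‖ ^ 2 +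
          ∑ J ∈ W.erase 0, ‖v₂ t₀ J - ((if J = 1 then -(g t₀ * s₂ 0 / (d 1 - d 0))
            else if J = -1 then g t₀ * s₂ (-1) / (d (-1) - d 0) else 0 : ℝ) : ℂ) * v₂ t₀ 0‖ ^ 2) := by positivity
    linarith
  -- total exponent (exact form) then the clean bound
  have hchain : Φ (t₀ + τ) ≤ Real.exp (-(2 * (1 - ε) * lam * τ) +
      2 * ((4 * β * γ ^ 2 * (Λ * |g₁| ^ 3 * σ + |g₁| / (ρ * τ) + Λ * |g₁| ^ 2) ^ 2 / (Gmin * Λ * Δ ^ 3)) * (2 * (ρ * τ)) +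
        (4 * β * γ ^ 2 * (Λ * |g₁| ^ 3 * σ + 0 + Λ * |g₁| ^ 2) ^ 2 / (Gmin * Λ * Δ ^ 3)) * (τ - 2 * (ρ * τ)))) * Φ t₀ := by
    by_cases hg0 : g₁ = 0
    · have hgz : ∀ t ∈ Icc t₀ (t₀ + τ), g t = 0 + 0 * t := by
        intro t ht; rw [hgdef t ht, hg0]; ring
      have hP := hpiece t₀ (t₀ + τ) 0 0 0 le_rfl (by linarith) le_rfl hgz (by simp)
      refine hP.trans (mul_le_mul_of_nonneg_right (Real.exp_le_exp.2 (le_of_eq ?_)) hΦ0)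
      simp only [hg0, abs_zero]
      ring
    have hg1 : ∀ t ∈ Icc t₀ (t₀ + ρ * τ), g t = -(g₁ * t₀ / (ρ * τ)) + g₁ / (ρ * τ) * t := by
      intro t ht
      rw [hgdef t ⟨ht.1, by linarith [ht.2, hρτle]⟩,
        trapezoid_eq_of_mem_ramp_up hτ hρ hρ2 ⟨by linarith [ht.1], by linarith [ht.2]⟩]
      field_simp
      ring
    have hP1 := hpiece t₀ (t₀ + ρ * τ) (-(g₁ * t₀ / (ρ * τ))) (g₁ / (ρ * τ)) (|g₁| / (ρ * τ)) le_rfl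
      (by linarith [hρτ.le]) (by linarith [hρτle]) hg1 (by rw [abs_div, abs_of_pos hρτ])
    have hg2 : ∀ t ∈ Icc (t₀ + ρ * τ) (t₀ + τ - ρ * τ), g t = g₁ + 0 * t := by
      intro t ht
      rw [hgdef t ⟨by linarith [ht.1, hρτ.le], by linarith [ht.2, hρτ.le]⟩,
        trapezoid_eq_of_mem_plateau hτ hρ ⟨by linarith [ht.1], by linarith [ht.2]⟩]
      ring
    have hP2 := hpiece (t₀ + ρ * τ) (t₀ + τ - ρ * τ) g₁ 0 0 (by linarith [hρτ.le]) (by linarith [h2ρτ])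
      (by linarith [hρτ.le]) hg2 (by simp)
    have hg3 : ∀ t ∈ Icc (t₀ + τ - ρ * τ) (t₀ + τ), g t = g₁ * (t₀ + τ) / (ρ * τ) + (-(g₁ / (ρ * τ))) * t := by
      intro t ht
      rw [hgdef t ⟨by linarith [ht.1, hρτle], ht.2⟩,
        trapezoid_eq_of_mem_ramp_down hτ hρ hρ2 ⟨by linarith [ht.1], by linarith [ht.2]⟩]
      field_simp
      ring
    have hP3 := hpiece (t₀ + τ - ρ * τ) (t₀ + τ) (g₁ * (t₀ + τ) / (ρ * τ)) (-(g₁ / (ρ * τ))) (|g₁| / (ρ * τ))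
      (by linarith [hρτle]) (by linarith [hρτ.le]) le_rfl hg3 (by rw [abs_neg, abs_div, abs_of_pos hρτ])
    have e12 : ∀ x y z : ℝ, Real.exp x * (Real.exp y * (Real.exp z * Φ t₀)) = Real.exp (x + y + z) * Φ t₀ := by
      intro x y z; rw [Real.exp_add, Real.exp_add]; ring
    have step := hP3.trans (mul_le_mul_of_nonneg_left
      (hP2.trans (mul_le_mul_of_nonneg_left hP1 (Real.exp_pos _).le)) (Real.exp_pos _).le)
    rw [e12] at step
    refine step.trans (mul_le_mul_of_nonneg_right (Real.exp_le_exp.2 (le_of_eq ?_)) hΦ0)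
    simp only [add_zero]
    ring
  -- simplifying the slack
  have hslack : 2 * ((4 * β * γ ^ 2 * (Λ * |g₁| ^ 3 * σ + |g₁| / (ρ * τ) + Λ * |g₁| ^ 2) ^ 2 / (Gmin * Λ * Δ ^ 3)) *
        (2 * (ρ * τ)) +
      (4 * β * γ ^ 2 * (Λ * |g₁| ^ 3 * σ + 0 + Λ * |g₁| ^ 2) ^ 2 / (Gmin * Λ * Δ ^ 3)) * (τ - 2 * (ρ * τ))) ≤
      (40 * β * γ ^ 2 * Λ * τ * g₁ ^ 4 * (1 + g₁ ^ 2 * σ ^ 2) / Δ ^ 3 + 48 * β * γ ^ 2 * g₁ ^ 2 / (ρ * τ * Λ * Δ ^ 3)) / Gmin := by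
    obtain ⟨A, hA⟩ : ∃ A : ℝ, A = |g₁| := ⟨_, rfl⟩
    have hA0 : 0 ≤ A := by rw [hA]; exact abs_nonneg _
    have e2 : A ^ 2 = g₁ ^ 2 := by rw [hA]; exact sq_abs _
    have e4 : A ^ 4 = g₁ ^ 4 := by rw [hA]; exact (by decide : Even 4).pow_abs g₁
    rw [← hA]
    obtain ⟨K, hK⟩ : ∃ K : ℝ, K = 8 * β * γ ^ 2 / (Gmin * Λ * Δ ^ 3) := ⟨_, rfl⟩
    have hK0 : 0 ≤ K := by rw [hK]; positivity
    obtain ⟨P, hP⟩ : ∃ P : ℝ, P = Λ * A ^ 3 * σ := ⟨_, rfl⟩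
    obtain ⟨Q, hQ⟩ : ∃ Q : ℝ, Q = A / (ρ * τ) := ⟨_, rfl⟩
    obtain ⟨R, hR⟩ : ∃ R : ℝ, R = Λ * A ^ 2 := ⟨_, rfl⟩
    have eL : 2 * ((4 * β * γ ^ 2 * (Λ * A ^ 3 * σ + A / (ρ * τ) + Λ * A ^ 2) ^ 2 / (Gmin * Λ * Δ ^ 3)) * (2 * (ρ * τ)) +
        (4 * β * γ ^ 2 * (Λ * A ^ 3 * σ + 0 + Λ * A ^ 2) ^ 2 / (Gmin * Λ * Δ ^ 3)) * (τ - 2 * (ρ * τ))) =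
        K * (2 * (ρ * τ)) * (P + Q + R) ^ 2 + K * (τ - 2 * (ρ * τ)) * (P + R) ^ 2 := by
      rw [hK, hP, hQ, hR, add_zero]; ring
    rw [eL]
    have hsq3 : (P + Q + R) ^ 2 ≤ 3 * (P ^ 2 + Q ^ 2 + R ^ 2) := by
      linarith only [sq_nonneg (P - Q), sq_nonneg (P - R), sq_nonneg (Q - R)]
    have hsq2 : (P + R) ^ 2 ≤ 2 * (P ^ 2 + R ^ 2) := by linarith only [sq_nonneg (P - R)]
    have hw1 : 0 ≤ K * (2 * (ρ * τ)) := mul_nonneg hK0 (by positivity)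
    have hw2 : 0 ≤ K * (τ - 2 * (ρ * τ)) := mul_nonneg hK0 (by linarith [h2ρτ])
    have t1 := mul_le_mul_of_nonneg_left hsq3 hw1
    have t2 := mul_le_mul_of_nonneg_left hsq2 hw2
    have eM : K * (2 * (ρ * τ)) * (3 * (P ^ 2 + Q ^ 2 + R ^ 2)) + K * (τ - 2 * (ρ * τ)) * (2 * (P ^ 2 + R ^ 2)) =
        K * τ * (2 + 2 * ρ) * (P ^ 2 + R ^ 2) + 6 * K * A ^ 2 / (ρ * τ) := by
      rw [hQ]; field_simp; ring
    have hPR : 0 ≤ K * τ * (P ^ 2 + R ^ 2) := by positivity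
    have hM1 : K * τ * (2 + 2 * ρ) * (P ^ 2 + R ^ 2) ≤ 3 * (K * τ * (P ^ 2 + R ^ 2)) := by
      have := mul_le_mul_of_nonneg_left (show 2 + 2 * ρ ≤ 3 by linarith only [hρ2]) hPR
      linarith only [this]
    have ePR : 3 * (K * τ * (P ^ 2 + R ^ 2)) = (24 * β * γ ^ 2 * Λ * τ * A ^ 4 * (1 + A ^ 2 * σ ^ 2) / Δ ^ 3) / Gmin := by
      rw [hK, hP, hR]; field_simp; ring
    have eQ : 6 * K * A ^ 2 / (ρ * τ) = (48 * β * γ ^ 2 * A ^ 2 / (ρ * τ * Λ * Δ ^ 3)) / Gmin := by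
      rw [hK]; field_simp; ring
    have hB : 0 ≤ β * γ ^ 2 * Λ * τ * A ^ 4 * (1 + A ^ 2 * σ ^ 2) / Δ ^ 3 / Gmin := by positivity
    have e40 : (40 * β * γ ^ 2 * Λ * τ * A ^ 4 * (1 + A ^ 2 * σ ^ 2) / Δ ^ 3 + 48 * β * γ ^ 2 * A ^ 2 / (ρ * τ * Λ * Δ ^ 3)) / Gmin =
        40 * (β * γ ^ 2 * Λ * τ * A ^ 4 * (1 + A ^ 2 * σ ^ 2) / Δ ^ 3 / Gmin) +
          (48 * β * γ ^ 2 * A ^ 2 / (ρ * τ * Λ * Δ ^ 3)) / Gmin := by ring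
    have e24 : (24 * β * γ ^ 2 * Λ * τ * A ^ 4 * (1 + A ^ 2 * σ ^ 2) / Δ ^ 3) / Gmin =
        24 * (β * γ ^ 2 * Λ * τ * A ^ 4 * (1 + A ^ 2 * σ ^ 2) / Δ ^ 3 / Gmin) := by ring
    rw [e2, e4] at *
    linarith only [t1, t2, eM, hM1, ePR, eQ, hB, e40, e24]
  rw [← hΦend (t₀ + τ) hg_t₁, ← hΦend t₀ hg_t₀]
  refine hchain.trans (mul_le_mul_of_nonneg_right (Real.exp_le_exp.2 ?_) hΦ0)
  linarith [hslack]

end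

end Summit.AnomalousDissipation.AnomalousDissipation.Theorems.SolenoidalFractalHomogenisation.RealisedQuasiStaticCellLaw
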